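import Summits.BirchSwinnertonDyer.BirchSwinnertonDyer.Theorems.TwoAdicConverseOrdLambdaHalfAtTwoBDPTwoVariableDefs
import Summits.BirchSwinnertonDyer.BirchSwinnertonDyer.Theorems.TwoAdicConverseBDPSelmerLowerDivisibilityAtTwoGaussContent
import Summits.BirchSwinnertonDyer.BirchSwinnertonDyer.Theorems.TwoAdicConverseBDPSelmerLowerDivisibilityAtTwoCharIdealPrincipal
import Literature.NumberTheory.EllipticCurves.ZpExtensionSplitPrimeLineThroughPair
import Literature.NumberTheory.EllipticCurves.ZpExtensionPairTowerUniversalProofs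
import Literature.NumberTheory.IwasawaTheory.IwasawaAlgebraTwoVar
import Mathlib.RingTheory.MvPowerSeries.Substitution
import Mathlib.RingTheory.PowerSeries.Binomial
import HarnessLib

/-!
# `split_prime_edge_pinning_two` — crux-idea NODE for O2 `BDPSelmerLowerDivisibilityAtTwo` (stmt-BirchSwinnertonDyer-24728),
# seat 2, round 1, GEN 8 (2026-08-30): ACPIN's «∃ prime 𝔓 of the special fibre» READ AT THE RESIDUAL PRIME OF THE `ℤ₂`-LINE
# UNRAMIFIED OUTSIDE THE RELAXED PRIME `v` — the one residual line where GL(1) Iwasawa theory at `2` is PRINT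

Lens (declared on HOME/STATUS): `barrier`@stub(ACPIN) — barrier-inversion of «Eisenstein/CM congruences degenerate at `p = 2`
POINTWISE» (Kriz–Li 2019 Thm. 1.20 is `p` odd; §7.5: at `p = 2` an Euler factor at `ℓ ∣ N` vanishes mod 2 AT THE POINT).  The
statement just outside that obstruction's class: read `μ` and `λ` of a RESTRICTED SERIES through VALUATIONS AT DEEP (wildly
ramified, `‖z‖ → 1`) points — a degenerate Euler factor `1 − (1+T)^c` is a NONZERO residual series (`μ = 0`, `λ = 2^{v₂(c)}`) even
though its value at every point is `≡ 0 mod 𝔪`.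

THE NODE (typed here; leaves tagged in `Lines/split_prime_edge_pinning_two.md`):
  O2 ⟸[`bdpSelmerLowerDivisibilityAtTwo_of_splitLine`, sorry-free] P0 (kernel, proved) ∧ CONTENT (kernel, proved) ∧ U (shared v7 stub)
        ∧ R0T (frame torsion; v7 DERIVES it from PRINT ∧ R0G ∧ P3–P5) ∧ Nᵥ (`SplitLineMuZeroAtTwo`) ∧ Λᵥ (`SplitLineLambdaAtTwo`)
  Nᵥ ∧ Λᵥ ⟹[`lineDvdAtTwo_of_splitLine`, sorry-free; the `v`-line EXISTS in every frame by the TREE: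
        `ZpExtension.exists_isUnramifiedOutside_of_split`, every `p`] LINEDVD (g3's weaker seam) ⟹ O2 (g3's unit-reflecting Gauss pin)
  Nᵥ ∧ Λᵥ ∧ L1 ⟹[`acFibrePinningAtTwo_of_splitLine`, sorry-free] ACPIN = v7's registered `stub_acFibrePinning` VERBATIM
        (`𝔓ᵥ := ker` of the residual line functional `redLineRes`, prime because `𝔽̄₂⟦T⟧` is a domain; L1 = `RedLineSurjective₂`,
        kernel: the residual line functional of a primitive covector is onto; primitivity of the covector `(κγ₁, κγ₂)` of a line
        through a presented pair is PROVED here, `isUnit_or_isUnit_of_line`, from the tree's pair-tower universality).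
  Nᵥ ⟸ EDGEᵥ ∧ DP ∧ PRINT(OV16 μ = 0 on the `𝔭`-ramified line at `p = 2`);  Λᵥ ⟸ EDGEᵥ ∧ DP ∧ PRINT(Müller 2020 Thm 1.3, tree fact
        `Muller2020.thm13_exists_nuBranch_charIdeal_eq`) ∧ ALGᵥ (kernel dévissage + Greenberg–Vatsal local matching on the `v`-line)
  — EDGEᵥ (research, R0G-class, INSTRUMENTABLE pointwise) and DP (`DeepPointResidual₁`, kernel, ATTACKABLE) are described in §5.
§0–§4 are VERBATIM this seat's GEN-3 annex `Lines/anticyclotomic_line_reading_two.lean` (lineSubst / lineRes / red₁ / the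
unit-reflecting Gauss pin / the LINEDVD road), re-declared because Cruxes files are not importable; §5–§6 are new.
NOT registered (`ledger skeleton check` slot of record = v7 `two_variable_gv_squeeze_two`); no stub of another seat touched.
HONESTY: nothing here is proved about any curve; BSD is proved for no curve; O2, U, R0T/R0G, Nᵥ, Λᵥ, EDGEᵥ stay OPEN; typed ≠ proved.
-/

set_option linter.dupNamespace false
set_option autoImplicit false

noncomputable section

open scoped Classical NumberField
open WeierstrassCurve NumberField IsDedekindDomain Field CategoryTheory Function CongruenceSubgroup
open Literature.NumberTheory.EllipticCurves Literature.NumberTheory.EllipticCurves.Rank1Residual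
open Literature.NumberTheory.EllipticCurves.ModularForms
open Literature.NumberTheory.GaloisRepresentations
open Literature.NumberTheory.EllipticCurves.IwasawaAlgebra₂ Literature.NumberTheory.EllipticCurves.UnrSeries₂
open Literature.NumberTheory.EllipticCurves.YanZhu2026
open Literature.NumberTheory.IwasawaTheory
open Summit.BirchSwinnertonDyer.BirchSwinnertonDyer.Theorems.TwoAdicKatoDeterminant
open Summit.BirchSwinnertonDyer.BirchSwinnertonDyer.Theorems.TwoAdicBDPGaussContent


namespace Summit.BirchSwinnertonDyer.BirchSwinnertonDyer.Cruxes.BDPSelmerLowerDivisibilityAtTwo.SplitPrimeEdgePinningTwo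

/-! ## §0 Shared pieces of the line of record `two_variable_gv_squeeze_two` (v3), re-declared character for character -/

/-- `𝒪_{ℂ₂}⟦T₁,T₂⟧` (outer `T₁ ↔ γ₁`, inner `T₂ ↔ γ₂`). [= `TwoVariableGvSqueezeTwo.A₂`] -/
abbrev A₂ : Type := PowerSeries (PowerSeries (PadicComplexInt 2))

/-- `𝔽̄₂⟦T₁,T₂⟧`. [= `TwoVariableGvSqueezeTwo.Ω₂`] -/
abbrev Ω₂ : Type := PowerSeries (PowerSeries (IsLocalRing.ResidueField (PadicComplexInt 2)))

/-- Coefficientwise reduction `𝒪_{ℂ₂}⟦T₁,T₂⟧ → 𝔽̄₂⟦T₁,T₂⟧`. [= `TwoVariableGvSqueezeTwo.red₂`] -/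
def red₂ : A₂ →+* Ω₂ := PowerSeries.map (PowerSeries.map (IsLocalRing.residue (PadicComplexInt 2)))

/-- **U at `(E,K)`** [= `TwoVariableGvSqueezeTwo.GreenbergUpperInclusionRatAt`, verbatim]: the Euler-system-directional
(UPPER) inclusion at `2` with `2`-power slack, for EVERY admissible frame datum. -/
def GreenbergUpperInclusionRatAt (W : WeierstrassCurve ℚ) [W.IsElliptic] [W.IsGloballyMinimal]
    (K : Type) [Field K] [NumberField K] : Prop :=
  ∀ [IsCMField K] (ι : PadicAlgCl 2 ≃+* ℂ) (v vbar : HeightOneSpectrum (𝓞 K)) (κ₁ κ₂ : ZpExtension K 2)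
    (γ₁ γ₂ : absoluteGaloisGroup K) [Fact (ZpExtension.IsTopGeneratorPair κ₁ κ₂ γ₁ γ₂)]
    [NeZero (W.conductorNorm ℤ)] (f : CuspForm (Gamma0 (W.conductorNorm ℤ)) 2),
    ModularForms.IsNewformOf W f → ∀ [NeZero (NumberField.discr K).natAbs],
    ((2 : ℕ) : 𝓞 K) ∈ v.asIdeal → ((2 : ℕ) : 𝓞 K) ∈ vbar.asIdeal → vbar ≠ v →
    (∀ (w : InfinitePlace K) (k : 𝓞 K), k ∈ v.asIdeal ↔ ‖ι.symm (w.embedding (k : K))‖ < 1) →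
    ∀ (Ω δ : ℂ) (Ωp : (unrIntegers 2)ˣ) (LK G : A₂),
      Ω ≠ 0 → (δ ^ 2 = (NumberField.discr K : ℂ) ∨ δ ^ 2 = -(NumberField.discr K : ℂ)) →
      IsKatzMeasure₂ ι v vbar ∅ κ₁ κ₂ γ₁⁻¹ γ₂⁻¹ 1 Ω δ ((Ωp : unrIntegers 2) : ℂ_[2]) LK →
      IsGreenbergLFunctionFree₂ ι v vbar κ₁ κ₂ γ₁⁻¹ γ₂⁻¹ f (NumberField.discr K).natAbs
        (NumberField.classNumber K) LK G →
      ∀ J : ℤ_[2] →+* PadicComplexInt 2,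
        (∀ x : ℤ_[2], ((J x : PadicComplexInt 2) : ℂ_[2]) = ((x : ℚ_[2]) : ℂ_[2])) →
        ∃ m : ℕ, Ideal.span {(2 : A₂) ^ m * G} ≤
          (WeierstrassCurve.XGr₂.charIdeal (W.baseChange K) 2 κ₁ κ₂ vbar γ₁ γ₂).map (toUnr₂ 2 J)

/-- **P0 at `(E,K)`** [= `TwoVariableGvSqueezeTwo.XGr₂CharIdealPrincipalAt`, verbatim]: principality of the two-variable
characteristic ideal of a torsion `X_Gr(E/K̃_∞)` (kernel algebra, proved: p766476). -/
def XGr₂CharIdealPrincipalAt (W : WeierstrassCurve ℚ) [W.IsElliptic] [W.IsGloballyMinimal]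
    (K : Type) [Field K] [NumberField K] : Prop :=
  ∀ (vbar : HeightOneSpectrum (𝓞 K)) (κ₁ κ₂ : ZpExtension K 2) (γ₁ γ₂ : absoluteGaloisGroup K)
    [Fact (ZpExtension.IsTopGeneratorPair κ₁ κ₂ γ₁ γ₂)],
    Module.IsTorsion (IwasawaAlgebra₂ 2) ((W.baseChange K).XGr₂ 2 κ₁ κ₂ vbar γ₁ γ₂) →
    ∃ C : IwasawaAlgebra₂ 2, WeierstrassCurve.XGr₂.charIdeal (W.baseChange K) 2 κ₁ κ₂ vbar γ₁ γ₂ = Ideal.span {C}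

/-- **R0T at `(E,K)`** [= `TwoVariableGvSqueezeTwo.GreenbergFrameTorsionAt`, verbatim]: an admissible frame datum exists at
`2` and `X_Gr(E/K̃_∞)` is `Λ_K`-torsion (the OBJECT half of R). -/
def GreenbergFrameTorsionAt (W : WeierstrassCurve ℚ) [W.IsElliptic] [W.IsGloballyMinimal]
    (K : Type) [Field K] [NumberField K] : Prop :=
  ∀ [IsCMField K] (ι : PadicAlgCl 2 ≃+* ℂ) (v vbar : HeightOneSpectrum (𝓞 K)) (κ₁ κ₂ : ZpExtension K 2)
    (γ₁ γ₂ : absoluteGaloisGroup K) [Fact (ZpExtension.IsTopGeneratorPair κ₁ κ₂ γ₁ γ₂)]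
    [NeZero (W.conductorNorm ℤ)] (f : CuspForm (Gamma0 (W.conductorNorm ℤ)) 2),
    ModularForms.IsNewformOf W f → ∀ [NeZero (NumberField.discr K).natAbs],
    ((2 : ℕ) : 𝓞 K) ∈ v.asIdeal → ((2 : ℕ) : 𝓞 K) ∈ vbar.asIdeal → vbar ≠ v →
    (∀ (w : InfinitePlace K) (k : 𝓞 K), k ∈ v.asIdeal ↔ ‖ι.symm (w.embedding (k : K))‖ < 1) →
    ∃ (Ω δ : ℂ) (Ωp : (unrIntegers 2)ˣ) (LK G : A₂),
      Ω ≠ 0 ∧ (δ ^ 2 = (NumberField.discr K : ℂ) ∨ δ ^ 2 = -(NumberField.discr K : ℂ)) ∧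
      IsKatzMeasure₂ ι v vbar ∅ κ₁ κ₂ γ₁⁻¹ γ₂⁻¹ 1 Ω δ ((Ωp : unrIntegers 2) : ℂ_[2]) LK ∧
      IsGreenbergLFunctionFree₂ ι v vbar κ₁ κ₂ γ₁⁻¹ γ₂⁻¹ f (NumberField.discr K).natAbs
        (NumberField.classNumber K) LK G ∧
      Module.IsTorsion (IwasawaAlgebra₂ 2) ((W.baseChange K).XGr₂ 2 κ₁ κ₂ vbar γ₁ γ₂)

/-- U on the habitat (β) [= `TwoVariableGvSqueezeTwo.TwoVariableUpperInclusionRatAtTwo`]. Research grade, shared. -/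
def TwoVariableUpperInclusionRatAtTwo : Prop :=
  ∀ (W : WeierstrassCurve ℚ) [W.IsElliptic] [W.IsGloballyMinimal],
    ¬ W.HasCM → GoodOrd W 2 → ¬ W.HasIrreducibleModPGaloisRep 2 →
    ∀ (K : Type) [Field K] [NumberField K],
      (IsImaginaryQuadratic K ∧ SatisfiesHeegnerHypothesis (2 * W.conductorNorm ℤ) K) →
      GreenbergUpperInclusionRatAt W K

/-- P0 on the habitat [= `TwoVariableGvSqueezeTwo.XGr₂CharIdealPrincipalAtTwo`]. Kernel algebra. -/
def XGr₂CharIdealPrincipalAtTwo : Prop :=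
  ∀ (W : WeierstrassCurve ℚ) [W.IsElliptic] [W.IsGloballyMinimal] (K : Type) [Field K] [NumberField K],
    XGr₂CharIdealPrincipalAt W K

/-- R0T on the habitat (β) [= `TwoVariableGvSqueezeTwo.TwoVariableFrameTorsionAtTwo`]. Research grade, shared. -/
def TwoVariableFrameTorsionAtTwo : Prop :=
  ∀ (W : WeierstrassCurve ℚ) [W.IsElliptic] [W.IsGloballyMinimal],
    ¬ W.HasCM → GoodOrd W 2 → ¬ W.HasIrreducibleModPGaloisRep 2 →
    ∀ (K : Type) [Field K] [NumberField K],
      (IsImaginaryQuadratic K ∧ SatisfiesHeegnerHypothesis (2 * W.conductorNorm ℤ) K) →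
      GreenbergFrameTorsionAt W K

/-- **CONTENT** [= seat 1's `AnticyclotomicFibrePinningTwo.TwoContent₂`, verbatim statement]: every non-zero `C₀ ∈ Λ_K = ℤ₂⟦T₁,T₂⟧`
reads along any `J : ℤ₂ → 𝒪_{ℂ₂}` as `J C₀ = 2^a · C₁` with `C₁` PRIMITIVE (`red₂ C₁ ≠ 0`); positive algebraic `μ` is allowed. -/
def TwoContent₂ : Prop :=
  ∀ (J : ℤ_[2] →+* PadicComplexInt 2) (C₀ : IwasawaAlgebra₂ 2), C₀ ≠ 0 →
    ∃ (a : ℕ) (C₁ : A₂), toUnr₂ 2 J C₀ = (2 : A₂) ^ a * C₁ ∧ red₂ C₁ ≠ 0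

/-- `2^a = C(C(2^a))` in `𝒪_{ℂ₂}⟦T₁,T₂⟧` (from p766427 `natCast_pow_eq_C_C`). -/
theorem two_pow_eq_C_C (a : ℕ) :
    (2 : A₂) ^ a = PowerSeries.C (PowerSeries.C ((2 : PadicComplexInt 2) ^ a)) := by
  have h := natCast_pow_eq_C_C (p := 2) a
  simpa only [Nat.cast_ofNat] using h

section Content
open PowerSeries in
/-- **CONTENT holds** (kernel).  PROOF = seat 1's `twoContent₂_holds` (`Lines/anticyclotomic_fibre_pinning_two.lean` §2,
planner-cruxidea-stmt-BirchSwinnertonDyer-24728-1 GEN 3), copied with attribution because Cruxes files are not importable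
(the lead's `TwoAdicBDPPrimePinning.exists_toUnr₂_eq_two_pow_mul_of_ne_zero` is the same port to `Theorems/`). [folklore] -/
theorem twoContent₂_holds : TwoContent₂ := by
  intro J C₀ hC₀
  have hcoef : ∃ ij : ℕ × ℕ, coeff ij.2 (coeff ij.1 C₀) ≠ 0 := by
    by_contra hall
    push Not at hall
    exact hC₀ (PowerSeries.ext fun i => PowerSeries.ext fun j => by simpa using hall (i, j))
  obtain ⟨ij₀, hij₀⟩ := hcoef
  have hirr : Irreducible (2 : ℤ_[2]) := by
    have h := PadicInt.irreducible_p (p := 2)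
    rwa [Nat.cast_ofNat] at h
  obtain ⟨n₀, c, hc, hn₀⟩ := WfDvdMonoid.max_power_factor hij₀ hirr
  have hex : ∃ n : ℕ, ∃ ij : ℕ × ℕ, ¬ ((2 : ℤ_[2]) ^ (n + 1) ∣ coeff ij.2 (coeff ij.1 C₀)) := by
    refine ⟨n₀, ij₀, fun hd => hc ?_⟩
    rw [hn₀, pow_succ] at hd
    exact (mul_dvd_mul_iff_left (pow_ne_zero n₀ hirr.ne_zero)).mp hd
  obtain ⟨a, ha_spec, ha_min⟩ : ∃ a : ℕ, (∃ ij : ℕ × ℕ, ¬ ((2 : ℤ_[2]) ^ (a + 1) ∣ coeff ij.2 (coeff ij.1 C₀))) ∧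
      ∀ n < a, ∀ ij : ℕ × ℕ, (2 : ℤ_[2]) ^ (n + 1) ∣ coeff ij.2 (coeff ij.1 C₀) := by
    refine ⟨Nat.find hex, Nat.find_spec hex, fun n hn ij => ?_⟩
    have hmin := Nat.find_min hex hn
    push Not at hmin
    exact hmin ij
  have hdiv : ∀ ij : ℕ × ℕ, ∃ d : ℤ_[2], coeff ij.2 (coeff ij.1 C₀) = (2 : ℤ_[2]) ^ a * d := by
    intro ij
    rcases Nat.eq_zero_or_pos a with ha | ha
    · exact ⟨coeff ij.2 (coeff ij.1 C₀), by rw [ha, pow_zero, one_mul]⟩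
    · obtain ⟨n, rfl⟩ : ∃ n, a = n + 1 := ⟨a - 1, by omega⟩
      exact ha_min n (Nat.lt_succ_self n) ij
  choose d hd using hdiv
  refine ⟨a, PowerSeries.mk fun i => PowerSeries.mk fun j => J (d (i, j)), ?_, ?_⟩
  · refine PowerSeries.ext fun i => PowerSeries.ext fun j => ?_
    rw [coeff_coeff_toUnr₂, hd (i, j), map_mul, map_pow, map_ofNat, two_pow_eq_C_C, PowerSeries.coeff_C_mul,
      PowerSeries.coeff_C_mul, PowerSeries.coeff_mk, PowerSeries.coeff_mk]
  · obtain ⟨ij₁, hij₁⟩ := ha_spec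
    have hd₁ : ¬ ((2 : ℤ_[2]) ∣ d ij₁) := by
      intro h2d
      apply hij₁
      rw [hd ij₁, pow_succ]
      exact mul_dvd_mul_left _ h2d
    have hunit : IsUnit (d ij₁) := by
      by_contra hnu
      apply hd₁
      have hmem : d ij₁ ∈ IsLocalRing.maximalIdeal ℤ_[2] :=
        (IsLocalRing.mem_maximalIdeal _).mpr (mem_nonunits_iff.mpr hnu)
      rw [PadicInt.maximalIdeal_eq_span_p, Ideal.mem_span_singleton] at hmem
      rwa [Nat.cast_ofNat] at hmem
    intro h0
    have hc := congrArg (fun F : Ω₂ => coeff ij₁.2 (coeff ij₁.1 F)) h0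
    simp only [red₂, PowerSeries.coeff_map, PowerSeries.coeff_mk, map_zero, Prod.mk.eta] at hc
    exact (IsLocalRing.residue_ne_zero_iff_isUnit _).mpr (hunit.map J) hc
end Content

/-! ## §1 Restriction of `𝒪⟦T₁,T₂⟧` to a line through the closed point (generic coefficient ring `𝒪`) -/

section LineSubst

variable {𝒪 : Type} [CommRing 𝒪]

/-- Images `u 0, u 1 ∈ T·𝒪⟦T⟧` are substitutable. -/
theorem hasSubst_line (u : Fin 2 → PowerSeries 𝒪) (hu : ∀ j, PowerSeries.constantCoeff (u j) = 0) :
    MvPowerSeries.HasSubst u :=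
  MvPowerSeries.hasSubst_of_constantCoeff_zero fun j => hu j

/-- **Restriction to a line**: the continuous `𝒪`-algebra map `𝒪⟦T₂⟧⟦T₁⟧ → 𝒪⟦T⟧`, `T₁ ↦ u 0`, `T₂ ↦ u 1`
(`u j ∈ T·𝒪⟦T⟧`), i.e. `F ↦ F(u₀(T), u₁(T))` — Mathlib's `MvPowerSeries.substAlgHom` after `𝒪⟦T₂⟧⟦T₁⟧ ≃ 𝒪⟦T₁,T₂⟧`. -/
def lineSubst (u : Fin 2 → PowerSeries 𝒪) (hu : ∀ j, PowerSeries.constantCoeff (u j) = 0) :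
    PowerSeries (PowerSeries 𝒪) →+* PowerSeries 𝒪 :=
  (MvPowerSeries.substAlgHom (R := 𝒪) (hasSubst_line u hu)).toRingHom.comp
    (nestedPowerSeriesEquiv (R := 𝒪)).toRingHom

theorem lineSubst_apply (u : Fin 2 → PowerSeries 𝒪) (hu : ∀ j, PowerSeries.constantCoeff (u j) = 0)
    (F : PowerSeries (PowerSeries 𝒪)) :
    lineSubst u hu F = MvPowerSeries.subst u (nestedPowerSeriesEquiv (R := 𝒪) F) := by
  show MvPowerSeries.substAlgHom (hasSubst_line u hu) (nestedPowerSeriesEquiv (R := 𝒪) F) = _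
  rw [MvPowerSeries.coe_substAlgHom]

/-- `T₁ ↦ u 0`. -/
theorem lineSubst_X (u : Fin 2 → PowerSeries 𝒪) (hu : ∀ j, PowerSeries.constantCoeff (u j) = 0) :
    lineSubst u hu PowerSeries.X = u 0 := by
  rw [lineSubst_apply, nestedPowerSeriesEquiv_X, MvPowerSeries.subst_X (hasSubst_line u hu)]

/-- `T₂ ↦ u 1`. -/
theorem lineSubst_C_X (u : Fin 2 → PowerSeries 𝒪) (hu : ∀ j, PowerSeries.constantCoeff (u j) = 0) :
    lineSubst u hu (PowerSeries.C PowerSeries.X) = u 1 := by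
  rw [lineSubst_apply, nestedPowerSeriesEquiv_C_X, MvPowerSeries.subst_X (hasSubst_line u hu)]

/-- **Restriction to a line preserves the augmentation**: `(F|_line)(0) = F(0,0)`. -/
theorem constantCoeff_lineSubst (u : Fin 2 → PowerSeries 𝒪) (hu : ∀ j, PowerSeries.constantCoeff (u j) = 0)
    (F : PowerSeries (PowerSeries 𝒪)) :
    PowerSeries.constantCoeff (lineSubst u hu F) = PowerSeries.constantCoeff (PowerSeries.constantCoeff F) := by
  rw [lineSubst_apply]
  show MvPowerSeries.constantCoeff (MvPowerSeries.subst u (nestedPowerSeriesEquiv (R := 𝒪) F)) = _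
  rw [MvPowerSeries.constantCoeff_subst (hasSubst_line u hu), finsum_eq_single _ 0]
  · rw [Finsupp.prod_zero_index, map_one, smul_eq_mul, mul_one, coeff_nestedPowerSeriesEquiv]
    simp
  · intro d hd
    have hs : ∃ s, d s ≠ 0 := by
      by_contra hcon
      push Not at hcon
      exact hd (Finsupp.ext fun s => by simpa using hcon s)
    obtain ⟨s, hs⟩ := hs
    have h0 : MvPowerSeries.constantCoeff (d.prod fun s e => u s ^ e) = 0 := by
      rw [map_finsuppProd, Finsupp.prod]
      exact Finset.prod_eq_zero (Finsupp.mem_support_iff.mpr hs)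
        (by rw [map_pow, show MvPowerSeries.constantCoeff (u s) = 0 from hu s]; exact zero_pow hs)
    rw [h0, smul_zero]

/-- **Restriction to a line reflects units** (`𝒪⟦T₂⟧⟦T₁⟧` and `𝒪⟦T⟧` are augmented: a series is a unit iff its
constant term is). -/
theorem isUnit_of_isUnit_lineSubst (u : Fin 2 → PowerSeries 𝒪) (hu : ∀ j, PowerSeries.constantCoeff (u j) = 0)
    {F : PowerSeries (PowerSeries 𝒪)} (h : IsUnit (lineSubst u hu F)) : IsUnit F := by
  rw [PowerSeries.isUnit_iff_constantCoeff, constantCoeff_lineSubst] at h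
  exact PowerSeries.isUnit_iff_constantCoeff.mpr (PowerSeries.isUnit_iff_constantCoeff.mpr h)

/-- Restriction to a line commutes with coefficientwise maps, in the form needed here: if every coefficient of `F`
dies under `r`, so does every coefficient of `F|_line`. -/
theorem map_lineSubst_eq_zero (u : Fin 2 → PowerSeries 𝒪) (hu : ∀ j, PowerSeries.constantCoeff (u j) = 0)
    {𝒪' : Type} [CommRing 𝒪'] (r : 𝒪 →+* 𝒪') {F : PowerSeries (PowerSeries 𝒪)}
    (hF : PowerSeries.map (PowerSeries.map r) F = 0) : PowerSeries.map r (lineSubst u hu F) = 0 := by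
  have hnat : MvPowerSeries.map r (nestedPowerSeriesEquiv (R := 𝒪) F) =
      nestedPowerSeriesEquiv (R := 𝒪') (PowerSeries.map (PowerSeries.map r) F) := by
    ext d
    simp [coeff_nestedPowerSeriesEquiv, PowerSeries.coeff_map]
  rw [lineSubst_apply]
  show MvPowerSeries.map r (MvPowerSeries.subst u (nestedPowerSeriesEquiv (R := 𝒪) F)) = 0
  rw [MvPowerSeries.map_subst (hasSubst_line u hu), hnat, hF, map_zero,
    ← MvPowerSeries.coe_substAlgHom ((hasSubst_line u hu).map r), map_zero]

end LineSubst

/-! ## §2 One-variable objects at `2` and the lines of an admissible frame -/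

/-- `𝒪_{ℂ₂}⟦T⟧`. -/
abbrev A₁ : Type := PowerSeries (PadicComplexInt 2)

/-- `𝔽̄₂⟦T⟧` (`𝔽̄₂` = residue field of `𝒪_{ℂ₂}`): a discrete valuation ring; ideals `(T^λ)`. -/
abbrev Ω₁ : Type := PowerSeries (IsLocalRing.ResidueField (PadicComplexInt 2))

/-- Coefficientwise reduction `𝒪_{ℂ₂}⟦T⟧ → 𝔽̄₂⟦T⟧`. -/
def red₁ : A₁ →+* Ω₁ := PowerSeries.map (IsLocalRing.residue (PadicComplexInt 2))

/-- `red₂ ∘ C = C ∘ red₁` (constants in the outer variable). -/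
theorem red₂_C (x : A₁) : red₂ (PowerSeries.C x) = PowerSeries.C (red₁ x) := by
  show PowerSeries.map _ (PowerSeries.C x) = _
  rw [PowerSeries.map_C]
  rfl

/-- The images of `T₁, T₂` on the `ℤ₂`-quotient line with covector `(a, b)` of a frame `(γ₁, γ₂)`:
`T₁ ↦ (1+T)^a − 1`, `T₂ ↦ (1+T)^b − 1` (outer `T₁ ↔ γ₁ ↦ a`, inner `T₂ ↔ γ₂ ↦ b`), along `J : ℤ₂ → 𝒪_{ℂ₂}`. -/
def lineImages (J : ℤ_[2] →+* PadicComplexInt 2) (a b : ℤ_[2]) : Fin 2 → A₁ :=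
  ![PowerSeries.map J (PowerSeries.binomialSeries ℤ_[2] a) - 1,
    PowerSeries.map J (PowerSeries.binomialSeries ℤ_[2] b) - 1]

theorem constantCoeff_lineImages (J : ℤ_[2] →+* PadicComplexInt 2) (a b : ℤ_[2]) :
    ∀ j, PowerSeries.constantCoeff (lineImages J a b j) = 0 := by
  have key : ∀ c : ℤ_[2],
      PowerSeries.constantCoeff (PowerSeries.map J (PowerSeries.binomialSeries ℤ_[2] c) - 1) = 0 := by
    intro c
    rw [map_sub, map_one, ← PowerSeries.coeff_zero_eq_constantCoeff_apply, PowerSeries.coeff_map,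
      PowerSeries.coeff_zero_eq_constantCoeff_apply, PowerSeries.binomialSeries_constantCoeff, map_one, sub_self]
  intro j
  fin_cases j
  · exact key a
  · exact key b

/-- **Restriction of `𝒪_{ℂ₂}⟦T₁,T₂⟧` to the line `(a, b)` of the frame.** -/
def lineRes (J : ℤ_[2] →+* PadicComplexInt 2) (a b : ℤ_[2]) : A₂ →+* A₁ :=
  lineSubst (lineImages J a b) (constantCoeff_lineImages J a b)

theorem isUnit_of_isUnit_lineRes (J : ℤ_[2] →+* PadicComplexInt 2) (a b : ℤ_[2]) :
    ∀ x : A₂, IsUnit (lineRes J a b x) → IsUnit x :=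
  fun _ h => isUnit_of_isUnit_lineSubst _ _ h

/-- `μ = 0` on a line forces two-variable `μ = 0`: `red₁ (F|_line) ≠ 0 → red₂ F ≠ 0`. -/
theorem red₂_ne_zero_of_red₁_lineRes_ne_zero (J : ℤ_[2] →+* PadicComplexInt 2) (a b : ℤ_[2]) {F : A₂}
    (h : red₁ (lineRes J a b F) ≠ 0) : red₂ F ≠ 0 :=
  fun hF => h (map_lineSubst_eq_zero _ _ (IsLocalRing.residue (PadicComplexInt 2)) hF)

/-! ## §3 The pieces (binder for binder the `∀`-frame of U of the line of record / of seat 1's `GreenbergAcFibrePinningAt`) -/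

/-- **ACLR at `(E,K)`** — the research LEAF, seat 1's `N_ac ∧ Λ_ac` READ INSIDE AN ARBITRARY FRAME: for every admissible frame
datum, structure map `J`, generator `C₀` of `ch(X_Gr(E/K̃_∞))` and primitive part `C₁` of `J C₀` (`J C₀ = 2^a·C₁`, `red₂ C₁ ≠ 0`),
there is a covector `(a', b')` of the pair `(γ₁, γ₂)` cutting out the ANTICYCLOTOMIC `ℤ₂`-extension such that on that line
(N) `μ(G|_line) = 0` and (Λ) `red(G|_line) ∣ red(C₁|_line)` in the DVR `𝔽̄₂⟦T⟧` («analytic `λ ≤` algebraic `λ`»). -/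
def GreenbergAcLineReadingForallAt (W : WeierstrassCurve ℚ) [W.IsElliptic] [W.IsGloballyMinimal]
    (K : Type) [Field K] [NumberField K] : Prop :=
  ∀ [IsCMField K] (ι : PadicAlgCl 2 ≃+* ℂ) (v vbar : HeightOneSpectrum (𝓞 K)) (κ₁ κ₂ : ZpExtension K 2)
    (γ₁ γ₂ : absoluteGaloisGroup K) [Fact (ZpExtension.IsTopGeneratorPair κ₁ κ₂ γ₁ γ₂)]
    [NeZero (W.conductorNorm ℤ)] (f : CuspForm (Gamma0 (W.conductorNorm ℤ)) 2),
    ModularForms.IsNewformOf W f → ∀ [NeZero (NumberField.discr K).natAbs],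
    ((2 : ℕ) : 𝓞 K) ∈ v.asIdeal → ((2 : ℕ) : 𝓞 K) ∈ vbar.asIdeal → vbar ≠ v →
    (∀ (w : InfinitePlace K) (k : 𝓞 K), k ∈ v.asIdeal ↔ ‖ι.symm (w.embedding (k : K))‖ < 1) →
    ∀ (Ω δ : ℂ) (Ωp : (unrIntegers 2)ˣ) (LK G : A₂),
      Ω ≠ 0 → (δ ^ 2 = (NumberField.discr K : ℂ) ∨ δ ^ 2 = -(NumberField.discr K : ℂ)) →
      IsKatzMeasure₂ ι v vbar ∅ κ₁ κ₂ γ₁⁻¹ γ₂⁻¹ 1 Ω δ ((Ωp : unrIntegers 2) : ℂ_[2]) LK →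
      IsGreenbergLFunctionFree₂ ι v vbar κ₁ κ₂ γ₁⁻¹ γ₂⁻¹ f (NumberField.discr K).natAbs
        (NumberField.classNumber K) LK G →
      ∀ J : ℤ_[2] →+* PadicComplexInt 2,
        (∀ x : ℤ_[2], ((J x : PadicComplexInt 2) : ℂ_[2]) = ((x : ℚ_[2]) : ℂ_[2])) →
        ∀ C₀ : IwasawaAlgebra₂ 2,
          WeierstrassCurve.XGr₂.charIdeal (W.baseChange K) 2 κ₁ κ₂ vbar γ₁ γ₂ = Ideal.span {C₀} →
          ∀ (a : ℕ) (C₁ : A₂), toUnr₂ 2 J C₀ = (2 : A₂) ^ a * C₁ → red₂ C₁ ≠ 0 →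
            ∃ (a' b' : ℤ_[2]) (hab : IsUnit a' ∨ IsUnit b'),
              (ZpExtension.ofLinComb (Fact.out : ZpExtension.IsTopGeneratorPair κ₁ κ₂ γ₁ γ₂) a' b' hab).IsAnticyclotomic ∧
              red₁ (lineRes J a' b' G) ≠ 0 ∧ red₁ (lineRes J a' b' G) ∣ red₁ (lineRes J a' b' C₁)

/-- **LINEDVD at `(E,K)`** — the WEAKER seam actually consumed by the kernel: (N) ∧ (Λ) on SOME `ℤ₂`-quotient line `(a', b')`
of the frame (no anticyclotomicity asked). -/
def GreenbergLineDvdForallAt (W : WeierstrassCurve ℚ) [W.IsElliptic] [W.IsGloballyMinimal]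
    (K : Type) [Field K] [NumberField K] : Prop :=
  ∀ [IsCMField K] (ι : PadicAlgCl 2 ≃+* ℂ) (v vbar : HeightOneSpectrum (𝓞 K)) (κ₁ κ₂ : ZpExtension K 2)
    (γ₁ γ₂ : absoluteGaloisGroup K) [Fact (ZpExtension.IsTopGeneratorPair κ₁ κ₂ γ₁ γ₂)]
    [NeZero (W.conductorNorm ℤ)] (f : CuspForm (Gamma0 (W.conductorNorm ℤ)) 2),
    ModularForms.IsNewformOf W f → ∀ [NeZero (NumberField.discr K).natAbs],
    ((2 : ℕ) : 𝓞 K) ∈ v.asIdeal → ((2 : ℕ) : 𝓞 K) ∈ vbar.asIdeal → vbar ≠ v →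
    (∀ (w : InfinitePlace K) (k : 𝓞 K), k ∈ v.asIdeal ↔ ‖ι.symm (w.embedding (k : K))‖ < 1) →
    ∀ (Ω δ : ℂ) (Ωp : (unrIntegers 2)ˣ) (LK G : A₂),
      Ω ≠ 0 → (δ ^ 2 = (NumberField.discr K : ℂ) ∨ δ ^ 2 = -(NumberField.discr K : ℂ)) →
      IsKatzMeasure₂ ι v vbar ∅ κ₁ κ₂ γ₁⁻¹ γ₂⁻¹ 1 Ω δ ((Ωp : unrIntegers 2) : ℂ_[2]) LK →
      IsGreenbergLFunctionFree₂ ι v vbar κ₁ κ₂ γ₁⁻¹ γ₂⁻¹ f (NumberField.discr K).natAbs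
        (NumberField.classNumber K) LK G →
      ∀ J : ℤ_[2] →+* PadicComplexInt 2,
        (∀ x : ℤ_[2], ((J x : PadicComplexInt 2) : ℂ_[2]) = ((x : ℚ_[2]) : ℂ_[2])) →
        ∀ C₀ : IwasawaAlgebra₂ 2,
          WeierstrassCurve.XGr₂.charIdeal (W.baseChange K) 2 κ₁ κ₂ vbar γ₁ γ₂ = Ideal.span {C₀} →
          ∀ (a : ℕ) (C₁ : A₂), toUnr₂ 2 J C₀ = (2 : A₂) ^ a * C₁ → red₂ C₁ ≠ 0 →
            ∃ (a' b' : ℤ_[2]), red₁ (lineRes J a' b' G) ≠ 0 ∧ red₁ (lineRes J a' b' G) ∣ red₁ (lineRes J a' b' C₁)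

/-- ACLR on the habitat (β) of O2 — research grade, THE leaf of this annex (= seat 1's `N_ac ∧ Λ_ac`, all pairs). -/
def AcLineReadingAtTwo : Prop :=
  ∀ (W : WeierstrassCurve ℚ) [W.IsElliptic] [W.IsGloballyMinimal],
    ¬ W.HasCM → GoodOrd W 2 → ¬ W.HasIrreducibleModPGaloisRep 2 →
    ∀ (K : Type) [Field K] [NumberField K],
      (IsImaginaryQuadratic K ∧ SatisfiesHeegnerHypothesis (2 * W.conductorNorm ℤ) K) →
      GreenbergAcLineReadingForallAt W K

/-- LINEDVD on the habitat (β) of O2 (the weaker seam). -/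
def LineDvdAtTwo : Prop :=
  ∀ (W : WeierstrassCurve ℚ) [W.IsElliptic] [W.IsGloballyMinimal],
    ¬ W.HasCM → GoodOrd W 2 → ¬ W.HasIrreducibleModPGaloisRep 2 →
    ∀ (K : Type) [Field K] [NumberField K],
      (IsImaginaryQuadratic K ∧ SatisfiesHeegnerHypothesis (2 * W.conductorNorm ℤ) K) →
      GreenbergLineDvdForallAt W K

theorem lineDvdAtTwo_of_acLineReadingAtTwo : AcLineReadingAtTwo → LineDvdAtTwo := by
  intro h W _ _ hCM hGO hβ K _ _ hK _ ι v vbar κ₁ κ₂ γ₁ γ₂ _ _ f hf _ hv hvbar hne hι Ω δ Ωp LK G hΩ hδ hLK hG J hJ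
    C₀ hC a C₁ hC₁ hred
  obtain ⟨a', b', _, _, hN, hΛ⟩ :=
    h W hCM hGO hβ K hK ι v vbar κ₁ κ₂ γ₁ γ₂ f hf hv hvbar hne hι Ω δ Ωp LK G hΩ hδ hLK hG J hJ C₀ hC a C₁ hC₁ hred
  exact ⟨a', b', hN, hΛ⟩

/-! ## §4 Kernel algebra (sorry-free) -/

/-- A series in `𝒪_{ℂ₂}⟦T⟧` whose reduction is a unit of `𝔽̄₂⟦T⟧` is a unit. -/
theorem isUnit_of_isUnit_red₁ {x : A₁} (h : IsUnit (red₁ x)) : IsUnit x := by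
  rw [PowerSeries.isUnit_iff_constantCoeff] at h ⊢
  have hc : PowerSeries.constantCoeff (red₁ x) =
      IsLocalRing.residue (PadicComplexInt 2) (PowerSeries.constantCoeff x) := by
    show PowerSeries.constantCoeff (PowerSeries.map _ x) = _
    rw [← PowerSeries.coeff_zero_eq_constantCoeff_apply, PowerSeries.coeff_map,
      PowerSeries.coeff_zero_eq_constantCoeff_apply]
  rw [hc] at h
  exact (IsLocalRing.residue_ne_zero_iff_isUnit _).mp h.ne_zero

/-- **The Gauss pin through a unit-reflecting ring map to `𝒪_{ℂ₂}⟦T⟧`** (pure commutative algebra over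
`A₂ = 𝒪_{ℂ₂}⟦T₁,T₂⟧`): if `2^n·G = F·h` with `red₂ F ≠ 0` (primitive `F`), and for SOME ring map `φ : A₂ → 𝒪_{ℂ₂}⟦T⟧` reflecting
units one has (N) `red₁(φ G) ≠ 0` and (Λ) `red₁(φ G) ∣ red₁(φ F)` in `𝔽̄₂⟦T⟧`, then `(F) ⊆ (G)`.  Proof: Gauss content (p766427) ⇒
`h = 2^n h₀`, `G = F h₀`; reduce along `φ`: `Ḡ = F̄ h̄₀ = q Ḡ h̄₀` in the domain `𝔽̄₂⟦T⟧` with `Ḡ ≠ 0` ⇒ `q h̄₀ = 1` ⇒ `h̄₀`, hence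
`φ h₀`, hence `h₀` is a unit.  (Lead's `TwoAdicBDPLinePin`: the case `φ = constantCoeff` / `map constantCoeff`; seat 1's
`PrimePinning₂`: the case «reduce first, then a prime `𝔓` of the special fibre».) -/
theorem span_le_span_of_two_pow_mul_eq_of_lineDvd (φ : A₂ →+* A₁) (hφ : ∀ x : A₂, IsUnit (φ x) → IsUnit x)
    (F G h : A₂) (n : ℕ) (hFh : (2 : A₂) ^ n * G = F * h) (hF : red₂ F ≠ 0) (hN : red₁ (φ G) ≠ 0)
    (hΛ : red₁ (φ G) ∣ red₁ (φ F)) : Ideal.span {F} ≤ Ideal.span {G} := by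
  have hFh' : ((2 : ℕ) : A₂) ^ n * G = F * h := by rw [Nat.cast_ofNat]; exact hFh
  have hFu : ∃ i : ℕ × ℕ, IsUnit (PowerSeries.coeff i.2 (PowerSeries.coeff i.1 F)) :=
    exists_isUnit_coeff_of_map_map_residue_ne_zero hF
  have hdvd : PowerSeries.C (PowerSeries.C (((2 : ℕ) : PadicComplexInt 2) ^ n)) ∣ F * h :=
    ⟨G, by rw [← hFh', natCast_pow_eq_C_C]⟩
  obtain ⟨h₀, rfl⟩ := C_C_dvd_of_C_C_dvd_mul_of_exists_isUnit_coeff hFu hdvd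
  have hG : G = F * h₀ := by
    refine mul_left_cancel₀ (C_C_ne_zero (pow_ne_zero n (natCast_prime_padicComplexInt_ne_zero (p := 2)))) ?_
    rw [← natCast_pow_eq_C_C, hFh', natCast_pow_eq_C_C]; ring
  obtain ⟨q, hq⟩ := hΛ
  -- in the domain `𝔽̄₂⟦T⟧`: `Ḡ = F̄·h̄₀ = Ḡ·q·h̄₀`, `Ḡ ≠ 0` ⇒ `q·h̄₀ = 1`
  have hunit : IsUnit (red₁ (φ h₀)) := by
    have h1 : red₁ (φ G) * (q * red₁ (φ h₀) - 1) = 0 := by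
      rw [mul_sub, mul_one, sub_eq_zero, ← mul_assoc, ← hq, ← map_mul, ← map_mul, ← hG]
    rcases mul_eq_zero.mp h1 with h0 | h0
    · exact absurd h0 hN
    · exact isUnit_iff_exists_inv'.mpr ⟨q, sub_eq_zero.mp h0⟩
  obtain ⟨u, hu⟩ := hφ h₀ (isUnit_of_isUnit_red₁ hunit)
  refine Ideal.span_singleton_le_span_singleton.mpr ⟨↑u⁻¹, ?_⟩
  rw [hG, ← hu, mul_assoc, Units.mul_inv, mul_one]

/-- **THE NODE, sorry-free**: `O2 ⟸ P0 ∧ CONTENT ∧ U ∧ R0T ∧ LINEDVD` (logic + the Gauss pin on a line of the frame). -/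
theorem bdpSelmerLowerDivisibilityAtTwo_of_lineDvd :
    XGr₂CharIdealPrincipalAtTwo → TwoContent₂ → TwoVariableUpperInclusionRatAtTwo → TwoVariableFrameTorsionAtTwo →
      LineDvdAtTwo → BDPSelmerLowerDivisibilityAtTwo := by
  intro hP hCt hU h0 hpin W _ _ hCM hGO hβ K _ _ hK _ ι v vbar κ₁ κ₂ γ₁ γ₂ _ _ f hf _ hv hvbar hne hι
  obtain ⟨Ω, δ, Ωp, LK, G, hΩ, hδ, hLK, hG, htor⟩ :=
    h0 W hCM hGO hβ K hK ι v vbar κ₁ κ₂ γ₁ γ₂ f hf hv hvbar hne hι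
  refine ⟨Ω, δ, Ωp, LK, G, hΩ, hδ, hLK, hG, htor, fun J hJ => ?_⟩
  obtain ⟨C₀, hC⟩ := hP W K vbar κ₁ κ₂ γ₁ γ₂ htor
  rw [hC, Ideal.map_span, Set.image_singleton]
  by_cases hC0 : C₀ = 0
  · rw [hC0, map_zero, Ideal.span_singleton_zero]
    exact bot_le
  obtain ⟨a, C₁, hC₁, hred⟩ := hCt J C₀ hC0
  obtain ⟨m, hm⟩ := hU W hCM hGO hβ K hK ι v vbar κ₁ κ₂ γ₁ γ₂ f hf hv hvbar hne hι Ω δ Ωp LK G hΩ hδ hLK hG J hJ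
  rw [hC, Ideal.map_span, Set.image_singleton] at hm
  obtain ⟨h, hh⟩ := Ideal.mem_span_singleton'.mp (hm (Ideal.mem_span_singleton_self _))
  have hFh : (2 : A₂) ^ m * G = C₁ * ((2 : A₂) ^ a * h) := by rw [← hh, hC₁]; ring
  obtain ⟨a', b', hN, hΛ⟩ :=
    hpin W hCM hGO hβ K hK ι v vbar κ₁ κ₂ γ₁ γ₂ f hf hv hvbar hne hι Ω δ Ωp LK G hΩ hδ hLK hG J hJ C₀ hC a C₁ hC₁ hred
  have hle : Ideal.span {C₁} ≤ Ideal.span {G} :=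
    span_le_span_of_two_pow_mul_eq_of_lineDvd (lineRes J a' b') (isUnit_of_isUnit_lineRes J a' b') C₁ G _ m hFh hred
      hN hΛ
  exact le_trans (Ideal.span_singleton_le_span_singleton.mpr ⟨(2 : A₂) ^ a, by rw [hC₁, mul_comm]⟩) hle

/-- **THE NODE with the research leaf**: `O2 ⟸ P0 ∧ CONTENT ∧ U ∧ R0T ∧ ACLR`, sorry-free. -/
theorem bdpSelmerLowerDivisibilityAtTwo_of_acLineReading :
    XGr₂CharIdealPrincipalAtTwo → TwoContent₂ → TwoVariableUpperInclusionRatAtTwo → TwoVariableFrameTorsionAtTwo →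
      AcLineReadingAtTwo → BDPSelmerLowerDivisibilityAtTwo :=
  fun hP hCt hU h0 hac =>
    bdpSelmerLowerDivisibilityAtTwo_of_lineDvd hP hCt hU h0 (lineDvdAtTwo_of_acLineReadingAtTwo hac)

/-! ## §5 (GEN 8, new) THE SPLIT-PRIME EDGE READING: (N) ∧ (Λ) on the `ℤ₂`-line UNRAMIFIED OUTSIDE THE RELAXED PRIME `v`

The frame's `v` is the prime induced by `ι` (`hι`); `X_Gr₂ … vbar` is unramified above `v̄` and carries NO condition above `v`
(RELAXED at `v`).  The `ℤ₂`-line `κ` with `κ.IsUnramifiedOutside v` is `K_∞^{(v)} ⊂ K(v^∞)` (Agboola's «unique `ℤ_p`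
extension unramified outside `𝔭`»); it exists for every `p` incl. `2` (tree `ZpExtension.exists_isUnramifiedOutside_of_split`),
lies in the tower of EVERY presented pair (tree `IsTopGeneratorPair.pairKer_le_kerSubgroup`) and is there the `ℤ₂`-combination
`κ = κ(γ₁)·κ₁ + κ(γ₂)·κ₂` (tree `IsTopGeneratorPair.toAdd_apply_eq_of_pairKer_le`); so its covector in the frame is
`(κ γ₁, κ γ₂)` and «restriction of `F ∈ 𝒪_{ℂ₂}⟦T₁,T₂⟧` to the line» is `lineRes J (κ γ₁) (κ γ₂) F`, with NO existential.

WHY THIS LINE (the lever).  On the special fibre `𝔽̄₂⟦T₁,T₂⟧` every translate of a `ℤ₂`-line by a character gives the SAME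
prime (characters of a pro-2 group are `≡ 1 mod 𝔪`), so the residual prime `𝔓ᵥ` of `K_∞^{(v)}` is met by the EDGE RAY
`{n = 0}` of `G`'s typed interpolation cone (`IsGreenbergLFunctionFree₂`: unramified `ξ` of type `(−(m+1), n+1)`), where the
Rankin–Selberg value is the HOLOMORPHIC pairing `⟨θ_ξ, f·E_{l−2}⟩` (no Maass–Shimura operator) and `f ≡ E′ mod 2` on habitat (β)
(`E(ℚ)[2] ≠ 0`; `E′ := E₂^{(N)} − a₀·24E₂^{(ℓ₀)}/(ℓ₀−1)`, auxiliary `ℓ₀ ≡ 3 mod 4`, fixes the constant term) turns `G|_edge` into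
`2·(CM-projector term) + [Katz × Katz × ∏_{𝔮∈Σ} Euler]|_edge`.  On the `v`-line the GL(1) inputs are PRINT at `2`: `μ = 0`
(Oukhaba–Viguié 2016 Thm 1.2, `p = 2, 3` allowed; Gillard), the main conjecture (Müller 2020 Thm 1.3 — tree fact
`Muller2020.thm13_exists_nuBranch_charIdeal_eq`; Choi–Kezuka–Li 2019 for `ℚ(√−7)`), versus the anticyclotomic line where
`μ(𝓛_𝔭^−) = 0` at `p = 2` is an OPEN QUESTION (OV16 p. 2) and versus the two-variable road (Rubin's MC at `2`, crux 24033, open).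

Leaves of Nᵥ / Λᵥ (informal; the card tags them):
* EDGEᵥ (research, R0G-class, INSTRUMENTABLE pointwise): at a sequence of deep edge points `z_i` (fixed edge weight, `v`-power
  conductor → ∞) `v₂(G(z_i) − u(z_i)·M(z_i)) ≥ c > 0` for a unit series `u` and the Σ-completed Eisenstein model
  `M = Tw(LK)·LK·∏_{𝔮∈Σ} P_𝔮`; content = uniform `2`-adic control (`> −1`) of Hida's normalised CM projector
  `h_K·𝓛ᵥ(ψ^{1−c})·⟨θ_ψ, ·⟩/⟨θ_ψ, θ_ψ⟩` on integral forms when `ρ̄_θ = 𝟙 ⊕ 𝟙` (Hida–Tilouine at `p = 2`: NOT in print) + matching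
  of the two frames' local constants at `v, v̄` up to units + V2: `G` interpolates at `v`-ramified edge points (Hida's RS measure).
* DP = `DeepPointResidual₁` below (kernel, ATTACKABLE): valuations at deep points determine the residual order.
* ALGᵥ (kernel + GV bookkeeping): on the `v`-line `λ(C₁|) = 2λ(X(K_∞^{(v)})) + 2Σ_{𝔮∈Σ} g_𝔮 − Σ λ(P_𝔮(E))` prime by prime
  (every odd `𝔮` is finitely decomposed in `K_∞^{(v)}`: residual Euler factor `(1+T)^c − 1`, `λ = 2^{v₂(c)} = g_𝔮`), the `v̄`-local
  discrepancy being pseudo-null on a line; the dévissage `0 → 𝟙 → E[2] → 𝟙 → 0` is v7's P5 on the same line. -/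

section MapLineSubst

variable {𝒪 : Type} [CommRing 𝒪]

/-- Restriction to a line COMMUTES with coefficientwise maps (general form of §1's `map_lineSubst_eq_zero`). -/
theorem map_lineSubst (u : Fin 2 → PowerSeries 𝒪) (hu : ∀ j, PowerSeries.constantCoeff (u j) = 0)
    {𝒪' : Type} [CommRing 𝒪'] (r : 𝒪 →+* 𝒪') (F : PowerSeries (PowerSeries 𝒪))
    (hu' : ∀ j, PowerSeries.constantCoeff (PowerSeries.map r (u j)) = 0) :
    PowerSeries.map r (lineSubst u hu F) =
      lineSubst (fun j => PowerSeries.map r (u j)) hu' (PowerSeries.map (PowerSeries.map r) F) := by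
  have hnat : MvPowerSeries.map r (nestedPowerSeriesEquiv (R := 𝒪) F) =
      nestedPowerSeriesEquiv (R := 𝒪') (PowerSeries.map (PowerSeries.map r) F) := by
    ext d
    simp [coeff_nestedPowerSeriesEquiv, PowerSeries.coeff_map]
  rw [lineSubst_apply, lineSubst_apply]
  show MvPowerSeries.map r (MvPowerSeries.subst u (nestedPowerSeriesEquiv (R := 𝒪) F)) = _
  rw [MvPowerSeries.map_subst (hasSubst_line u hu), hnat]
  rfl

end MapLineSubst

theorem constantCoeff_red₁_lineImages (J : ℤ_[2] →+* PadicComplexInt 2) (a b : ℤ_[2]) :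
    ∀ j, PowerSeries.constantCoeff (PowerSeries.map (IsLocalRing.residue (PadicComplexInt 2)) (lineImages J a b j)) = 0 := by
  intro j
  rw [← PowerSeries.coeff_zero_eq_constantCoeff_apply, PowerSeries.coeff_map, PowerSeries.coeff_zero_eq_constantCoeff_apply,
    constantCoeff_lineImages J a b j, map_zero]

/-- **The RESIDUAL line functional** `𝔽̄₂⟦T₁,T₂⟧ → 𝔽̄₂⟦T⟧` of the line with covector `(a, b)`: substitute the reduced images
`red((1+T)^a − 1)`, `red((1+T)^b − 1)`.  Its kernel `𝔓_{(a,b)}` is the RESIDUAL PRIME of the line (prime: `𝔽̄₂⟦T⟧` is a domain);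
all translates of the line by characters have the same residual prime. -/
def redLineRes (J : ℤ_[2] →+* PadicComplexInt 2) (a b : ℤ_[2]) : Ω₂ →+* Ω₁ :=
  lineSubst (fun j => PowerSeries.map (IsLocalRing.residue (PadicComplexInt 2)) (lineImages J a b j))
    (constantCoeff_red₁_lineImages J a b)

/-- `redLineRes ∘ red₂ = red₁ ∘ lineRes` (reduce-then-restrict = restrict-then-reduce). KERNEL, proved. -/
theorem redLineRes_red₂ (J : ℤ_[2] →+* PadicComplexInt 2) (a b : ℤ_[2]) (x : A₂) :
    redLineRes J a b (red₂ x) = red₁ (lineRes J a b x) :=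
  (map_lineSubst (lineImages J a b) (constantCoeff_lineImages J a b) (IsLocalRing.residue (PadicComplexInt 2)) x
    (constantCoeff_red₁_lineImages J a b)).symm

/-- **PRIMITIVITY of the covector of a line through a presented pair** (`[K:ℚ] ≤ 2`, every `p`; here `p = 2`): for a
generator pair `(κ₁, κ₂; γ₁, γ₂)` and ANY `ℤ₂`-extension `κ` of `K`, one of `κ γ₁`, `κ γ₂` is a unit of `ℤ₂`
(`κ = κ(γ₁)κ₁ + κ(γ₂)κ₂` is onto `ℤ₂`).  KERNEL, proved from the tree's pair-tower universality. -/
theorem isUnit_or_isUnit_of_line {K : Type} [Field K] [NumberField K] (hK2 : Module.finrank ℚ K ≤ 2)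
    {κ₁ κ₂ : ZpExtension K 2} {γ₁ γ₂ : absoluteGaloisGroup K} (hpair : ZpExtension.IsTopGeneratorPair κ₁ κ₂ γ₁ γ₂)
    (κ : ZpExtension K 2) :
    IsUnit (Multiplicative.toAdd (κ γ₁)) ∨ IsUnit (Multiplicative.toAdd (κ γ₂)) := by
  by_contra h
  push Not at h
  obtain ⟨σ, hσ⟩ : ∃ σ : absoluteGaloisGroup K, κ σ = Multiplicative.ofAdd 1 :=
    κ.surjective (Multiplicative.ofAdd 1)
  have key := hpair.toAdd_apply_eq_of_pairKer_le (hpair.pairKer_le_kerSubgroup hK2 κ) σ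
  rw [hσ, toAdd_ofAdd] at key
  have hm : ∀ x : ℤ_[2], ¬ IsUnit x → x ∈ IsLocalRing.maximalIdeal ℤ_[2] := fun x hx =>
    (IsLocalRing.mem_maximalIdeal _).mpr (mem_nonunits_iff.mpr hx)
  have h1 : (1 : ℤ_[2]) ∈ IsLocalRing.maximalIdeal ℤ_[2] := by
    rw [key]
    exact Ideal.add_mem _ (Ideal.mul_mem_right _ _ (hm _ h.1)) (Ideal.mul_mem_right _ _ (hm _ h.2))
  exact (IsLocalRing.maximalIdeal.isMaximal ℤ_[2]).ne_top ((Ideal.eq_top_iff_one _).mpr h1)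

/-- **Nᵥ at `(E,K)`** (piece, UNDECIDED vs the crux; `μ`-half): for every admissible frame datum and structure map `J`, on every
`ℤ₂`-line `κ` of `K` unramified outside the RELAXED prime `v` (covector `(κγ₁, κγ₂)` in the frame): `red(G|_κ) ≠ 0`, i.e.
`μ(G|_{K_∞^{(v)}}) = 0`.  [⟸ EDGEᵥ ∧ DP ∧ Oukhaba–Viguié 2016 Thm 1.2 (`μ(X(K_∞^{(𝔭)})) = 0`, all `p`) ∧ Euler factors.] -/
def GreenbergSplitLineMuZeroForallAt (W : WeierstrassCurve ℚ) [W.IsElliptic] [W.IsGloballyMinimal]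
    (K : Type) [Field K] [NumberField K] : Prop :=
  ∀ [IsCMField K] (ι : PadicAlgCl 2 ≃+* ℂ) (v vbar : HeightOneSpectrum (𝓞 K)) (κ₁ κ₂ : ZpExtension K 2)
    (γ₁ γ₂ : absoluteGaloisGroup K) [Fact (ZpExtension.IsTopGeneratorPair κ₁ κ₂ γ₁ γ₂)]
    [NeZero (W.conductorNorm ℤ)] (f : CuspForm (Gamma0 (W.conductorNorm ℤ)) 2),
    ModularForms.IsNewformOf W f → ∀ [NeZero (NumberField.discr K).natAbs],
    ((2 : ℕ) : 𝓞 K) ∈ v.asIdeal → ((2 : ℕ) : 𝓞 K) ∈ vbar.asIdeal → vbar ≠ v →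
    (∀ (w : InfinitePlace K) (k : 𝓞 K), k ∈ v.asIdeal ↔ ‖ι.symm (w.embedding (k : K))‖ < 1) →
    ∀ (Ω δ : ℂ) (Ωp : (unrIntegers 2)ˣ) (LK G : A₂),
      Ω ≠ 0 → (δ ^ 2 = (NumberField.discr K : ℂ) ∨ δ ^ 2 = -(NumberField.discr K : ℂ)) →
      IsKatzMeasure₂ ι v vbar ∅ κ₁ κ₂ γ₁⁻¹ γ₂⁻¹ 1 Ω δ ((Ωp : unrIntegers 2) : ℂ_[2]) LK →
      IsGreenbergLFunctionFree₂ ι v vbar κ₁ κ₂ γ₁⁻¹ γ₂⁻¹ f (NumberField.discr K).natAbs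
        (NumberField.classNumber K) LK G →
      ∀ J : ℤ_[2] →+* PadicComplexInt 2,
        (∀ x : ℤ_[2], ((J x : PadicComplexInt 2) : ℂ_[2]) = ((x : ℚ_[2]) : ℂ_[2])) →
        ∀ κ : ZpExtension K 2, κ.IsUnramifiedOutside v →
          red₁ (lineRes J (Multiplicative.toAdd (κ γ₁)) (Multiplicative.toAdd (κ γ₂)) G) ≠ 0

/-- **Λᵥ at `(E,K)`** (piece, WEAKER than O2 ∧ U; `λ`-half): for every admissible frame datum, `J`, generator `C₀` of
`ch_{Λ_K}(X_Gr₂)` and primitive part `C₁` of `J C₀` (`J C₀ = 2^a·C₁`, `red C₁ ≠ 0`), on every `ℤ₂`-line `κ` unramified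
outside `v`: `red(G|_κ) ∣ red(C₁|_κ)` in the DVR `𝔽̄₂⟦T⟧` — given Nᵥ, exactly `λ(G|_κ) ≤ λ(C₁|_κ)`.
[⟸ EDGEᵥ ∧ DP ∧ Müller 2020 Thm 1.3 (`Muller2020.thm13_exists_nuBranch_charIdeal_eq`) ∧ ALGᵥ.] -/
def GreenbergSplitLineLambdaForallAt (W : WeierstrassCurve ℚ) [W.IsElliptic] [W.IsGloballyMinimal]
    (K : Type) [Field K] [NumberField K] : Prop :=
  ∀ [IsCMField K] (ι : PadicAlgCl 2 ≃+* ℂ) (v vbar : HeightOneSpectrum (𝓞 K)) (κ₁ κ₂ : ZpExtension K 2)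
    (γ₁ γ₂ : absoluteGaloisGroup K) [Fact (ZpExtension.IsTopGeneratorPair κ₁ κ₂ γ₁ γ₂)]
    [NeZero (W.conductorNorm ℤ)] (f : CuspForm (Gamma0 (W.conductorNorm ℤ)) 2),
    ModularForms.IsNewformOf W f → ∀ [NeZero (NumberField.discr K).natAbs],
    ((2 : ℕ) : 𝓞 K) ∈ v.asIdeal → ((2 : ℕ) : 𝓞 K) ∈ vbar.asIdeal → vbar ≠ v →
    (∀ (w : InfinitePlace K) (k : 𝓞 K), k ∈ v.asIdeal ↔ ‖ι.symm (w.embedding (k : K))‖ < 1) →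
    ∀ (Ω δ : ℂ) (Ωp : (unrIntegers 2)ˣ) (LK G : A₂),
      Ω ≠ 0 → (δ ^ 2 = (NumberField.discr K : ℂ) ∨ δ ^ 2 = -(NumberField.discr K : ℂ)) →
      IsKatzMeasure₂ ι v vbar ∅ κ₁ κ₂ γ₁⁻¹ γ₂⁻¹ 1 Ω δ ((Ωp : unrIntegers 2) : ℂ_[2]) LK →
      IsGreenbergLFunctionFree₂ ι v vbar κ₁ κ₂ γ₁⁻¹ γ₂⁻¹ f (NumberField.discr K).natAbs
        (NumberField.classNumber K) LK G →
      ∀ J : ℤ_[2] →+* PadicComplexInt 2,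
        (∀ x : ℤ_[2], ((J x : PadicComplexInt 2) : ℂ_[2]) = ((x : ℚ_[2]) : ℂ_[2])) →
        ∀ C₀ : IwasawaAlgebra₂ 2,
          WeierstrassCurve.XGr₂.charIdeal (W.baseChange K) 2 κ₁ κ₂ vbar γ₁ γ₂ = Ideal.span {C₀} →
          ∀ (a : ℕ) (C₁ : A₂), toUnr₂ 2 J C₀ = (2 : A₂) ^ a * C₁ → red₂ C₁ ≠ 0 →
            ∀ κ : ZpExtension K 2, κ.IsUnramifiedOutside v →
              red₁ (lineRes J (Multiplicative.toAdd (κ γ₁)) (Multiplicative.toAdd (κ γ₂)) G) ∣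
                red₁ (lineRes J (Multiplicative.toAdd (κ γ₁)) (Multiplicative.toAdd (κ γ₂)) C₁)

/-- Nᵥ on the habitat (β) of O2. -/
def SplitLineMuZeroAtTwo : Prop :=
  ∀ (W : WeierstrassCurve ℚ) [W.IsElliptic] [W.IsGloballyMinimal],
    ¬ W.HasCM → GoodOrd W 2 → ¬ W.HasIrreducibleModPGaloisRep 2 →
    ∀ (K : Type) [Field K] [NumberField K],
      (IsImaginaryQuadratic K ∧ SatisfiesHeegnerHypothesis (2 * W.conductorNorm ℤ) K) →
      GreenbergSplitLineMuZeroForallAt W K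

/-- Λᵥ on the habitat (β) of O2. -/
def SplitLineLambdaAtTwo : Prop :=
  ∀ (W : WeierstrassCurve ℚ) [W.IsElliptic] [W.IsGloballyMinimal],
    ¬ W.HasCM → GoodOrd W 2 → ¬ W.HasIrreducibleModPGaloisRep 2 →
    ∀ (K : Type) [Field K] [NumberField K],
      (IsImaginaryQuadratic K ∧ SatisfiesHeegnerHypothesis (2 * W.conductorNorm ℤ) K) →
      GreenbergSplitLineLambdaForallAt W K

/-- **SEAM (KERNEL, proved): Nᵥ ∧ Λᵥ ⟹ LINEDVD.**  The `v`-line exists in every frame (tree, class field theory for the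
imaginary quadratic `K`, every `p`), so the split reading supplies the line g3's Gauss-pin road consumes. -/
theorem lineDvdAtTwo_of_splitLine : SplitLineMuZeroAtTwo → SplitLineLambdaAtTwo → LineDvdAtTwo := by
  intro hN hΛ W _ _ hCM hGO hβ K _ _ hK _ ι v vbar κ₁ κ₂ γ₁ γ₂ _ _ f hf _ hv hvbar hne hι Ω δ Ωp LK G hΩ hδ hLK hG J hJ
    C₀ hC a C₁ hC₁ hred
  obtain ⟨κ, hκ⟩ := ZpExtension.exists_isUnramifiedOutside_of_split (p := 2) hK.1 hv hvbar hne
  exact ⟨_, _, hN W hCM hGO hβ K hK ι v vbar κ₁ κ₂ γ₁ γ₂ f hf hv hvbar hne hι Ω δ Ωp LK G hΩ hδ hLK hG J hJ κ hκ,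
    hΛ W hCM hGO hβ K hK ι v vbar κ₁ κ₂ γ₁ γ₂ f hf hv hvbar hne hι Ω δ Ωp LK G hΩ hδ hLK hG J hJ C₀ hC a C₁ hC₁ hred κ hκ⟩

/-- **THE NODE (sorry-free): O2 ⟸ P0 ∧ CONTENT ∧ U ∧ R0T ∧ Nᵥ ∧ Λᵥ** (logic + g3's unit-reflecting Gauss pin on the `v`-line). -/
theorem bdpSelmerLowerDivisibilityAtTwo_of_splitLine :
    XGr₂CharIdealPrincipalAtTwo → TwoContent₂ → TwoVariableUpperInclusionRatAtTwo → TwoVariableFrameTorsionAtTwo →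
      SplitLineMuZeroAtTwo → SplitLineLambdaAtTwo → BDPSelmerLowerDivisibilityAtTwo :=
  fun hP hCt hU h0 hN hΛ => bdpSelmerLowerDivisibilityAtTwo_of_lineDvd hP hCt hU h0 (lineDvdAtTwo_of_splitLine hN hΛ)

/-! ### §5b The same leaf in v7's ACPIN currency (`FibrePinned`, seat 1 / line of record v7, VERBATIM decls) -/

/-- **FibrePinned G C'** (v7 / seat 1, verbatim) — SOME prime `𝔓` of `𝔽̄₂⟦T₁,T₂⟧` with (N) `red G ∉ 𝔓` and (Λ) for every
primitive part `C₁` of `C'` (`C' = 2^a·C₁`, `red C₁ ≠ 0`): `red C₁ ∈ 𝔓 + (red G)`. -/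
def FibrePinned (G C' : A₂) : Prop :=
  ∃ 𝔓 : Ideal Ω₂, 𝔓.IsPrime ∧ red₂ G ∉ 𝔓 ∧
    ∀ (a : ℕ) (C₁ : A₂), C' = (2 : A₂) ^ a * C₁ → red₂ C₁ ≠ 0 → red₂ C₁ ∈ 𝔓 ⊔ Ideal.span {red₂ G}

/-- **ACPIN at `(E,K)`** (v7 / seat 1, verbatim). -/
def GreenbergAcFibrePinningAt (W : WeierstrassCurve ℚ) [W.IsElliptic] [W.IsGloballyMinimal]
    (K : Type) [Field K] [NumberField K] : Prop :=
  ∀ [IsCMField K] (ι : PadicAlgCl 2 ≃+* ℂ) (v vbar : HeightOneSpectrum (𝓞 K)) (κ₁ κ₂ : ZpExtension K 2)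
    (γ₁ γ₂ : absoluteGaloisGroup K) [Fact (ZpExtension.IsTopGeneratorPair κ₁ κ₂ γ₁ γ₂)]
    [NeZero (W.conductorNorm ℤ)] (f : CuspForm (Gamma0 (W.conductorNorm ℤ)) 2),
    ModularForms.IsNewformOf W f → ∀ [NeZero (NumberField.discr K).natAbs],
    ((2 : ℕ) : 𝓞 K) ∈ v.asIdeal → ((2 : ℕ) : 𝓞 K) ∈ vbar.asIdeal → vbar ≠ v →
    (∀ (w : InfinitePlace K) (k : 𝓞 K), k ∈ v.asIdeal ↔ ‖ι.symm (w.embedding (k : K))‖ < 1) →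
    ∀ (Ω δ : ℂ) (Ωp : (unrIntegers 2)ˣ) (LK G : A₂),
      Ω ≠ 0 → (δ ^ 2 = (NumberField.discr K : ℂ) ∨ δ ^ 2 = -(NumberField.discr K : ℂ)) →
      IsKatzMeasure₂ ι v vbar ∅ κ₁ κ₂ γ₁⁻¹ γ₂⁻¹ 1 Ω δ ((Ωp : unrIntegers 2) : ℂ_[2]) LK →
      IsGreenbergLFunctionFree₂ ι v vbar κ₁ κ₂ γ₁⁻¹ γ₂⁻¹ f (NumberField.discr K).natAbs
        (NumberField.classNumber K) LK G →
      ∀ J : ℤ_[2] →+* PadicComplexInt 2,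
        (∀ x : ℤ_[2], ((J x : PadicComplexInt 2) : ℂ_[2]) = ((x : ℚ_[2]) : ℂ_[2])) →
        ∀ C₀ : IwasawaAlgebra₂ 2,
          WeierstrassCurve.XGr₂.charIdeal (W.baseChange K) 2 κ₁ κ₂ vbar γ₁ γ₂ = Ideal.span {C₀} →
          FibrePinned G (toUnr₂ 2 J C₀)

/-- **ACPIN on the habitat (β)** (v7 / seat 1, verbatim = the registered `stub_acFibrePinning`'s statement). -/
def AcFibrePinningAtTwo : Prop :=
  ∀ (W : WeierstrassCurve ℚ) [W.IsElliptic] [W.IsGloballyMinimal],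
    ¬ W.HasCM → GoodOrd W 2 → ¬ W.HasIrreducibleModPGaloisRep 2 →
    ∀ (K : Type) [Field K] [NumberField K],
      (IsImaginaryQuadratic K ∧ SatisfiesHeegnerHypothesis (2 * W.conductorNorm ℤ) K) →
      GreenbergAcFibrePinningAt W K

/-- **L1 (KERNEL leaf, ATTACKABLE): the residual line functional of a PRIMITIVE covector is onto** (`a` a unit ⟹
`red((1+T)^a − 1) = T + …` has order one ⟹ `𝔽̄₂⟦T₁,T₂⟧ → 𝔽̄₂⟦T⟧` hits `T·(unit)`, hence everything; symmetric in `b`). -/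
def RedLineSurjective₂ : Prop :=
  ∀ (J : ℤ_[2] →+* PadicComplexInt 2) (a b : ℤ_[2]), IsUnit a ∨ IsUnit b → Function.Surjective (redLineRes J a b)

/-- **KERNEL (proved): a line reading in `∣`-currency through an ONTO residual functional `φ` pins the fibre at `𝔓 := ker φ`**
(prime since `𝔽̄₂⟦T⟧` is a domain; the quotient lifts along `φ`).  v7's `fibrePinned_of_lineReading` in `∣`-currency. -/
theorem fibrePinned_of_redLine {φ : Ω₂ →+* Ω₁} (hφ : Function.Surjective φ) {G C' : A₂} (hN : φ (red₂ G) ≠ 0)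
    (hΛ : ∀ (a : ℕ) (C₁ : A₂), C' = (2 : A₂) ^ a * C₁ → red₂ C₁ ≠ 0 → φ (red₂ G) ∣ φ (red₂ C₁)) :
    FibrePinned G C' := by
  refine ⟨RingHom.ker φ, RingHom.ker_isPrime φ, fun h => hN ((RingHom.mem_ker).mp h), fun a C₁ hC₁ hred => ?_⟩
  obtain ⟨q, hq⟩ := hΛ a C₁ hC₁ hred
  obtain ⟨q', rfl⟩ := hφ q
  have hk : red₂ C₁ - q' * red₂ G ∈ RingHom.ker φ := by
    rw [RingHom.mem_ker, map_sub, map_mul, hq]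
    ring
  have hsplit : red₂ C₁ = (red₂ C₁ - q' * red₂ G) + q' * red₂ G := by ring
  rw [hsplit]
  exact Ideal.add_mem _ (Ideal.mem_sup_left hk) (Ideal.mem_sup_right (Ideal.mem_span_singleton'.mpr ⟨q', rfl⟩))

/-- **SEAM to the line of record (KERNEL, proved modulo the kernel leaf L1): Nᵥ ∧ Λᵥ ∧ L1 ⟹ ACPIN** — v7's registered
`stub_acFibrePinning` statement, with `𝔓 := 𝔓ᵥ = ker (redLineRes J (κγ₁) (κγ₂))` the residual prime of the `v`-line. -/
theorem acFibrePinningAtTwo_of_splitLine (hL1 : RedLineSurjective₂) :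
    SplitLineMuZeroAtTwo → SplitLineLambdaAtTwo → AcFibrePinningAtTwo := by
  intro hN hΛ W _ _ hCM hGO hβ K _ _ hK _ ι v vbar κ₁ κ₂ γ₁ γ₂ _ _ f hf _ hv hvbar hne hι Ω δ Ωp LK G hΩ hδ hLK hG J hJ C₀ hC
  obtain ⟨κ, hκ⟩ := ZpExtension.exists_isUnramifiedOutside_of_split (p := 2) hK.1 hv hvbar hne
  have hprim := isUnit_or_isUnit_of_line hK.1.1.le
    (Fact.out : ZpExtension.IsTopGeneratorPair κ₁ κ₂ γ₁ γ₂) κ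
  refine fibrePinned_of_redLine (hL1 J _ _ hprim) ?_ ?_
  · rw [redLineRes_red₂]
    exact hN W hCM hGO hβ K hK ι v vbar κ₁ κ₂ γ₁ γ₂ f hf hv hvbar hne hι Ω δ Ωp LK G hΩ hδ hLK hG J hJ κ hκ
  · intro a C₁ hC₁ hred
    rw [redLineRes_red₂, redLineRes_red₂]
    exact hΛ W hCM hGO hβ K hK ι v vbar κ₁ κ₂ γ₁ γ₂ f hf hv hvbar hne hι Ω δ Ωp LK G hΩ hδ hLK hG J hJ C₀ hC a C₁ hC₁ hred κ hκ

/-! ### §5c The deep-point residual lemma (KERNEL leaf DP, typed; one variable) -/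

/-- **DP — `DeepPointResidual₁` (KERNEL, ATTACKABLE; elementary ultrametric dominance).**  For `D ∈ 𝒪_{ℂ₂}⟦T⟧` and points
`z_i ∈ 𝔪_{ℂ₂}` with `‖z_i‖ → 1`: if the values `D(z_i)` stay in a ball `‖·‖ ≤ c < 1`, then `red D = 0`.  (If `red D ≠ 0`
with order `n₀`, then `‖D(z)‖ = ‖z‖^{n₀}` as soon as `‖z‖^{n₀} > max_{n<n₀} ‖d_n‖`; so `‖D(z_i)‖ → 1`.)  Consequence used by
the node: if `G|_ℓ − u·M|_ℓ` is `2`-adically small at a deep sequence then `red(G|_ℓ) = red(u)·red(M|_ℓ)`, so `μ` and `λ` of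
`G|_ℓ` are those of the Eisenstein model `M|_ℓ` — read from PRINT.  Values are series sums in `ℂ₂`; no evaluation API assumed. -/
def DeepPointResidual₁ : Prop :=
  ∀ (D : A₁) (z : ℕ → PadicComplexInt 2) (y : ℕ → ℂ_[2]) (c : ℝ), c < 1 →
    (∀ i, ‖((z i : PadicComplexInt 2) : ℂ_[2])‖ < 1) →
    Filter.Tendsto (fun i => ‖((z i : PadicComplexInt 2) : ℂ_[2])‖) Filter.atTop (nhds 1) →
    (∀ i, HasSum (fun n : ℕ => ((PowerSeries.coeff n D : PadicComplexInt 2) : ℂ_[2]) *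
      ((z i : PadicComplexInt 2) : ℂ_[2]) ^ n) (y i)) →
    (∀ i, ‖y i‖ ≤ c) → red₁ D = 0

/-- DP, degenerate direction (sanity, KERNEL, proved): the zero series has all deep values `0`. -/
theorem deepPointResidual₁_zero_hasSum (z : PadicComplexInt 2) :
    HasSum (fun n : ℕ => ((PowerSeries.coeff n (0 : A₁) : PadicComplexInt 2) : ℂ_[2]) *
      ((z : PadicComplexInt 2) : ℂ_[2]) ^ n) 0 := by
  simp

/-! ## §6 Stubs of THIS node (NOT registered — the slot of record is v7 `two_variable_gv_squeeze_two`) and the composition BY NAME -/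

/-- **stub P0** (KERNEL, proved — p766476 — by name). -/
theorem stub_charIdealPrincipal : XGr₂CharIdealPrincipalAtTwo :=
  fun W _ _ K _ _ vbar κ₁ κ₂ γ₁ γ₂ _ h =>
    Summit.BirchSwinnertonDyer.BirchSwinnertonDyer.Theorems.TwoAdicBDPCharIdealPrincipal.exists_xGr₂_charIdeal_eq_span_two
      W K vbar κ₁ κ₂ γ₁ γ₂ h

/-- **stub CONTENT** (KERNEL, proved in §0). -/
theorem stub_twoContent : TwoContent₂ := twoContent₂_holds

/-- **stub U** (research, SHARED statement with v7's registered `stub_upperInclusionRat`). -/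
theorem stub_upperInclusionRat : TwoVariableUpperInclusionRatAtTwo := by
  sorry

/-- **stub R0T** (SHARED statement `TwoVariableFrameTorsionAtTwo`; v7 DERIVES it: PRINT `thmII417` ∧ R0G ∧ P3 ∧ P4 ∧ P5). -/
theorem stub_frameTorsion : TwoVariableFrameTorsionAtTwo := by
  sorry

/-- **stub Nᵥ** (research ∧ PRINT: EDGEᵥ ∧ DP ∧ OV16 Thm 1.2): `μ(G|_{K_∞^{(v)}}) = 0` in every frame. -/
theorem stub_splitLineMuZero : SplitLineMuZeroAtTwo := by
  sorry

/-- **stub Λᵥ** (research ∧ PRINT ∧ kernel: EDGEᵥ ∧ DP ∧ Müller 2020 Thm 1.3 ∧ ALGᵥ): `red(G|ᵥ) ∣ red(C₁|ᵥ)` in every frame. -/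
theorem stub_splitLineLambda : SplitLineLambdaAtTwo := by
  sorry

/-- **Composition BY NAME**: the crux `BDPSelmerLowerDivisibilityAtTwo` from `stub_charIdealPrincipal` (P0, kernel),
`stub_twoContent` (CONTENT, kernel), `stub_upperInclusionRat` (U), `stub_frameTorsion` (R0T), `stub_splitLineMuZero` (Nᵥ),
`stub_splitLineLambda` (Λᵥ).  Sorries = exactly {U, R0T, Nᵥ, Λᵥ}. -/
theorem BDPSelmerLowerDivisibilityAtTwo_of_splitLine : BDPSelmerLowerDivisibilityAtTwo :=
  bdpSelmerLowerDivisibilityAtTwo_of_splitLine stub_charIdealPrincipal stub_twoContent stub_upperInclusionRat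
    stub_frameTorsion stub_splitLineMuZero stub_splitLineLambda

end Summit.BirchSwinnertonDyer.BirchSwinnertonDyer.Cruxes.BDPSelmerLowerDivisibilityAtTwo.SplitPrimeEdgePinningTwo

end
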